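import Summits.CriticalPhenomena.CardyFormulaZ2.Theses.CardyQContinuation

/-!
# Crux `IsingJetsConformal`, stub `stub_loopSymmetricLimit_pathLower`:
# an open path between the two collars contains an open `EΩ`-stretch between the wired arcs
# (route `CardyQContinuation`, item stmt-CriticalPhenomena-5560)

Deterministic half of the LOWER sandwich of the crux's `n = 0` bridge. The edge set of a big graph
`G` is covered by the discretisation's edges `EΩ` and two collars `C₀`, `C₂`; a vertex incident to a
`C₀`-edge and to an `EΩ`-edge lies in the wired arc `W₀` (similarly `C₂` / `W₂`); no vertex is
incident to both a `C₀`-edge and a `C₂`-edge; every edge of `G` at `x` lies in `C₀ \ EΩ` and every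
edge of `G` at `y` lies in `C₂ \ EΩ`. Claim: if `x ≠ y` are joined by a path of the open graph of a
configuration `ω ⊆ G.edgeSet`, then some `x' ∈ W₀` and `y' ∈ W₂` are joined by a path of the open
graph of `ω ∩ EΩ`.

Proof (walk surgery, organised as ONE induction on the walk, `PathLower.walk_aux`, carrying two
"states"): state A = "the current vertex is incident to a `C₀`-edge of `G`", state B = "some
`x' ∈ W₀` reaches the current vertex in the open graph of `ω ∩ EΩ`, and the current vertex is
incident to an `EΩ`-edge of `G`". Reading the next edge `s(a, b) ∈ ω ⊆ EΩ ∪ C₀ ∪ C₂` of the walk: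
in state A, a `C₂`-edge is excluded (no vertex sees both collars), a `C₀`-edge keeps state A, an
`EΩ`-edge puts `a ∈ W₀` and enters state B; in state B, a `C₂`-edge gives `a ∈ W₂` and the
conclusion, an `EΩ`-edge extends the stretch, a `C₀`-edge returns to state A. At the endpoint `y`
both states are contradictory (an edge of `G` at `y` is in `C₂` and not in `EΩ`). The first edge
of the walk contains `x`, hence lies in `C₀`, which starts the induction in state A.

References: folklore (path decomposition at the first collar change); used for the FK/percolation
comparison of crossing events in G. Grimmett, *The Random-Cluster Model* (2006), §6, and
D. Chelkak, S. Smirnov, Invent. Math. 189 (2012), §6.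
-/

namespace Summit.CriticalPhenomena.CardyFormulaZ2.Theorems.CardyQContinuation

open Literature.Probability.Percolation

namespace PathLower

variable {V : Type*} {G : SimpleGraph V} {EΩ C₀ C₂ : Set (Sym2 V)} {W₀ W₂ : Set V}
  {ω : Set (Sym2 V)}

/-- **Walk induction** for `stub_loopSymmetricLimit_pathLower`. For a walk `p` of the open graph
of `ω` from `v` to the black vertex `y` (every edge of `G` at `y` is in `C₂` and not in `EΩ`):
(A) if `v` is incident to a `C₀`-edge of `G`, and (B) if some `x' ∈ W₀` reaches `v` in the open
graph of `ω ∩ EΩ` and `v` is incident to an `EΩ`-edge of `G`, then some `x' ∈ W₀` and `y' ∈ W₂`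
are joined in the open graph of `ω ∩ EΩ`. Both claims are proved simultaneously by induction on
`p`, classifying the first edge as `C₂`, else `C₀`/`EΩ`. [folklore] -/
theorem walk_aux (hω : ω ⊆ G.edgeSet) (hcov : G.edgeSet ⊆ EΩ ∪ C₀ ∪ C₂)
    (hW₀ : ∀ x : V, (∃ e ∈ C₀, x ∈ e) → (∃ e ∈ EΩ, x ∈ e) → x ∈ W₀)
    (hW₂ : ∀ x : V, (∃ e ∈ C₂, x ∈ e) → (∃ e ∈ EΩ, x ∈ e) → x ∈ W₂)
    (hdisj : ∀ x : V, (∃ e ∈ C₀, x ∈ e) → ¬ ∃ e ∈ C₂, x ∈ e)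
    {v y : V} (p : (openGraph ω).Walk v y) :
    (∀ e ∈ G.edgeSet, y ∈ e → e ∈ C₂ ∧ e ∉ EΩ) →
    ((∃ e ∈ C₀, e ∈ G.edgeSet ∧ v ∈ e) →
      ∃ x' ∈ W₀, ∃ y' ∈ W₂, (openGraph (ω ∩ EΩ)).Reachable x' y') ∧
    ((∃ x' ∈ W₀, (openGraph (ω ∩ EΩ)).Reachable x' v) →
      (∃ e ∈ EΩ, e ∈ G.edgeSet ∧ v ∈ e) →
      ∃ x' ∈ W₀, ∃ y' ∈ W₂, (openGraph (ω ∩ EΩ)).Reachable x' y') := by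
  induction p with
  | nil =>
    intro hy
    refine ⟨?_, ?_⟩
    · rintro ⟨e, heC₀, heG, hve⟩
      exact absurd ⟨e, (hy e heG hve).1, hve⟩ (hdisj _ ⟨e, heC₀, hve⟩)
    · rintro - ⟨e, heE, heG, hve⟩
      exact absurd heE (hy e heG hve).2
  | @cons a b c hadj p ih =>
    intro hy
    have hab : s(a, b) ∈ ω ∧ a ≠ b := (openGraph_adj ω a b).1 hadj
    have heG : s(a, b) ∈ G.edgeSet := hω hab.1
    have hcases : s(a, b) ∈ EΩ ∪ C₀ ∪ C₂ := hcov heG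
    have ha : a ∈ s(a, b) := Sym2.mem_mk_left a b
    have hb : b ∈ s(a, b) := Sym2.mem_mk_right a b
    obtain ⟨ihA, ihB⟩ := ih hy
    -- the edge `s(a, b)` as an edge of the open graph of `ω ∩ EΩ`, when it lies in `EΩ`
    have hreachE : s(a, b) ∈ EΩ → (openGraph (ω ∩ EΩ)).Reachable a b := fun hE =>
      SimpleGraph.Adj.reachable ((openGraph_adj (ω ∩ EΩ) a b).2 ⟨⟨hab.1, hE⟩, hab.2⟩)
    refine ⟨?_, ?_⟩
    · rintro ⟨e, heC₀, -, hae⟩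
      by_cases h₂ : s(a, b) ∈ C₂
      · exact absurd ⟨s(a, b), h₂, ha⟩ (hdisj a ⟨e, heC₀, hae⟩)
      by_cases h₀ : s(a, b) ∈ C₀
      · exact ihA ⟨s(a, b), h₀, heG, hb⟩
      have hE : s(a, b) ∈ EΩ := by
        rcases hcases with (hE | h₀') | h₂'
        · exact hE
        · exact absurd h₀' h₀
        · exact absurd h₂' h₂
      exact ihB ⟨a, hW₀ a ⟨e, heC₀, hae⟩ ⟨s(a, b), hE, ha⟩, hreachE hE⟩ ⟨s(a, b), hE, heG, hb⟩
    · rintro ⟨x', hx', hreach⟩ ⟨e, heE, -, hae⟩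
      by_cases h₂ : s(a, b) ∈ C₂
      · exact ⟨x', hx', a, hW₂ a ⟨s(a, b), h₂, ha⟩ ⟨e, heE, hae⟩, hreach⟩
      by_cases hE : s(a, b) ∈ EΩ
      · exact ihB ⟨x', hx', hreach.trans (hreachE hE)⟩ ⟨s(a, b), hE, heG, hb⟩
      have h₀ : s(a, b) ∈ C₀ := by
        rcases hcases with (hE' | h₀) | h₂'
        · exact absurd hE' hE
        · exact h₀
        · exact absurd h₂' h₂
      exact ihA ⟨s(a, b), h₀, heG, hb⟩

end PathLower

open PathLower

/-- **Stub `stub_loopSymmetricLimit_pathLower`** of the skeleton of the crux `IsingJetsConformal`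
(stmt-CriticalPhenomena-5560), deterministic half of the lower sandwich of the `n = 0` bridge:
with `G.edgeSet ⊆ EΩ ∪ C₀ ∪ C₂`, wired arcs `W₀ ⊇ {vertices incident to a C₀- and an EΩ-edge}`,
`W₂ ⊇ {vertices incident to a C₂- and an EΩ-edge}`, no vertex incident to both collars, `x` seeing
only `C₀ \ EΩ` edges and `y` only `C₂ \ EΩ` edges, every open path of `ω ⊆ G.edgeSet` from `x` to
`y ≠ x` yields `x' ∈ W₀`, `y' ∈ W₂` joined by an open path of `ω ∩ EΩ`. The first edge of the
path contains `x`, hence is a `C₀`-edge of `G`, and `PathLower.walk_aux` (A) applies to the rest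
of the walk. [folklore] -/
theorem stub_loopSymmetricLimit_pathLower : (∀ (V : Type) (G : SimpleGraph V) (EΩ C₀ C₂ : Set (Sym2 V)) (W₀ W₂ : Set V) (ω : Set (Sym2 V)), ω ⊆ G.edgeSet → G.edgeSet ⊆ EΩ ∪ C₀ ∪ C₂ → (∀ x : V, (∃ e ∈ C₀, x ∈ e) → (∃ e ∈ EΩ, x ∈ e) → x ∈ W₀) → (∀ x : V, (∃ e ∈ C₂, x ∈ e) → (∃ e ∈ EΩ, x ∈ e) → x ∈ W₂) → (∀ x : V, (∃ e ∈ C₀, x ∈ e) → ¬ ∃ e ∈ C₂, x ∈ e) → ∀ x y : V, x ≠ y → (∀ e ∈ G.edgeSet, x ∈ e → e ∈ C₀ ∧ e ∉ EΩ) → (∀ e ∈ G.edgeSet, y ∈ e → e ∈ C₂ ∧ e ∉ EΩ) → (Literature.Probability.Percolation.openGraph ω).Reachable x y → ∃ x' ∈ W₀, ∃ y' ∈ W₂, (Literature.Probability.Percolation.openGraph (ω ∩ EΩ)).Reachable x' y') := by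
  intro V G EΩ C₀ C₂ W₀ W₂ ω hω hcov hW₀ hW₂ hdisj x y hxy hx hy hreach
  obtain ⟨p⟩ := hreach
  cases p with
  | nil => exact absurd rfl hxy
  | @cons _ b _ hadj p =>
    have hxb : s(x, b) ∈ ω ∧ x ≠ b := (openGraph_adj ω x b).1 hadj
    have heG : s(x, b) ∈ G.edgeSet := hω hxb.1
    exact (walk_aux hω hcov hW₀ hW₂ hdisj p hy).1
      ⟨s(x, b), (hx _ heG (Sym2.mem_mk_left x b)).1, heG, Sym2.mem_mk_right x b⟩

end Summit.CriticalPhenomena.CardyFormulaZ2.Theorems.CardyQContinuation
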